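import Summits.HubbardSuperconductivity.HubbardSuperconductivity.Theses.GibbsMajorant
import Literature.MathematicalPhysics.QuantumLattice.FreeFermiGasNoThermalPairFieldLRO

/-!
# Birth skeleton (BC3) for crux `ThermalWindowMajorant` — stmt-HubbardSuperconductivity-15716
(route `GibbsMajorant`, rank 2; sub-problem `HubbardSuperconductivity`)

Planner `planner-skel-stmt-HubbardSuperconductivity-15716-0`, 2026-08-17 (skeleton-register, re-audit
bin REPAIRABLE). Published as `Cruxes/ThermalWindowMajorant/Lines/birth.lean`.

The crux is the FIXED-TEMPERATURE, GROUND-ANCHORED exponential (Chernoff) bound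
`e^{βE₀ + aθL²} · Re Tr( e^{-βH} · P e^{-aW_ε} P ) ≤ 1/2` for the Kac-window pair operator `W_ε`
in the `(N_L, S^z = 0)` sector (`P` its projector, `E₀` its ground energy) of
`H = hubbardTorus 2 L 1 U`, eventually in even `L`, at some `(U, δ, θ, ε₁)`, `β = β(ε)`, `a = a(L)`.
The line registered here is the route header's own foreseen second layer ("by TimeChessboard with
k fixed ⇐ SlicedPenaltyBound", TWO-LAYER PLAN), cut along the seam REFLECTION POSITIVITY IN TIME /
CONSTRAINED PARTITION FUNCTION:

* `stub_sectorChessboard : SectorChessboard` — the SECTOR TIME-CHESSBOARD estimate (finite-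
  dimensional, Literature-grade, provable now; size L): for Hermitian `H`, an orthogonal projection
  `P` commuting with `H`, Hermitian `X`, real `β` and `N = 2^(c+1)` slices,
  `(Re Tr(e^{-βH} PXP))^N ≤ Re Tr((PXP · e^{-βH/N})^N) · (Re Tr(e^{-βH} P))^{N-1}`.
  This is the tracial Hölder inequality `|Tr(A₁⋯A_N)| ≤ Π ‖A_j‖_N` with `A₁ = S^{1/2}(PXP)S^{1/2}`,
  `A_j = S := e^{-βH/N}P` (`j ≥ 2`): `‖A₁‖_N^N = Tr((PXP·S)^N)`, `‖S‖_N^N = Tr(e^{-βH}P)`; at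
  dyadic `N` it follows from the Schwarz inequality for the trace form (tree:
  `Literature…TraceInequalities.norm_trace_mul_le`, Petz's dyadic chain
  `norm_trace_mul_pow_two_pow_le`) by the Fröhlich–Israel–Lieb–Simon iteration. It strictly
  generalises the route's support `TimeChessboard` (the case `P = 1`), which is useless here as
  stated: the full Fock-space partition function `Tr e^{-βH}` is dominated by other particle
  numbers (`hubbardTorus` carries no chemical potential), so the chessboard must be run INSIDE the
  sector, with `Z_S = Tr(e^{-βH}P)`. Sources: DysonLiebSimon1978 §3, FrohlichIsraelLiebSimon1978
  Thm 4.1, FriedliVelenik2017 (10.24)–(10.26).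
* `stub_slicedWindowBound : SlicedWindowBound` — THE PHYSICS (hardest stub; open): at some
  `(U > 0, δ ∈ (0,1/2), θ > 0, ε₁ > 0)`, for every window radius `ε ∈ (0, ε₁]` a fixed `β > 0` and,
  eventually in even `L`, a tilt `a ≥ 0` and a dyadic slice number `N = 2^(c+1) ≥ 2` with
  `Re Tr((P e^{-aW_ε} P · e^{-βH/N})^N) · Z_S^{N-1} ≤ (½ e^{-βE₀ - aθL²})^N`,
  i.e. the `N`-slice PENALTY-INSERTED sector partition function, normalised by `Z_S`, is at most the
  `N`-th power of the one-slice target `½ e^{-βE₀ - aθL²}/Z_S`. This is the reflection-positive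
  (in imaginary time) constrained partition function that chessboard / contour (quantum
  Pirogov–Sinai) / cluster methods estimate — the "native currency" named in the route's WHY THIS
  LINE — and by Araki–Lieb–Thirring it is sandwiched between the genuinely penalised partition
  function `Tr(P e^{-(βH + NaW_ε)})` (below) and the one-slice tilted trace at tilt `Na` (above).
  `N = 1` is EXCLUDED on purpose: with one slice the statement would be the crux body verbatim
  (costume); with `N ≥ 2` the converse `crux → stub` is not available and `stub → crux` is exactly
  the chessboard estimate. Why it might fail: as for the crux (fixed `T ≲ e_cond` below every
  convergent expansion; the large-deviation rate of window-poor states must beat the configurational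
  entropy `log Z_S + βE₀`), now `N`-fold. Sources: FriedliVelenik2017 Thm 10.11 / Lemma 10.19,
  DysonLiebSimon1978, BorgsKoteckyUeltschi1996, DattaFernandezFrohlich1999.

Composition `ThermalWindowMajorant_of : SectorChessboard → SlicedWindowBound → ThermalWindowMajorant`
(hypotheses spelled `__Registered.stub_X`, `rfl`-aliases keyed by the stub names, for the native
audit) is proved below WITHOUT `sorry`: the abstract root extraction `crux_body_of_sliced`
(`T^N ≤ M·Z_S^{N-1} ≤ t^N`, `t = ½e^{-βE₀-aθL²} > 0` ⟹ `T ≤ t` ⟹ `e^{βE₀+aθL²}·T ≤ ½`) applied at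
`H = hubbardTorus 2 L 1 U` (Hermitian: `LiebThm1.hamiltonian_isHermitian`), `P = projMatrix` of the
sector (Hermitian idempotent, `projMatrix_isHermitian`, `projMatrix_mul_self`; commutes with `H`:
`projMatrix_szSector_commute`) and `X = e^{-aW_ε}` (Hermitian: `W_ε` is a real combination of
`Dᴴ D`'s, `Matrix.isHermitian_gibbsWeight`). It concludes the route decl
`Summit.HubbardSuperconductivity.HubbardSuperconductivity.Theses.GibbsMajorant.ThermalWindowMajorant`
BY NAME. Sorries live only in the two `stub_*` theorems.

Disproof used: none relevant (no `Cruxes/ThermalWindowMajorant/Disproof.lean`, no landed Negative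
lemma for this crux, `ledger crux ls` empty, negatives index 2 unrelated entries, 2026-08-17). The
`U = 0` calibration that kills the `U := 0` instance of `KacWindowPenalty.WindowGap`
(`Theorems/WindowGap/Negative/FreeWindowCalibration.lean`) would likewise kill the `U := 0` instance
of `stub_slicedWindowBound`; the stub quantifies `∃ U > 0`. Degenerate audit: `N = 1` excluded (see
above); `a = 0` admissible but then the stub demands `Z_S·e^{βE₀} ≤ ½·(…)`, false since
`Z_S ≥ e^{-βE₀}` — so every witness has `a > 0`, as it should; empty sector impossible (`P ≠ 0` for
`δ < 1/2`, `L ≥ 2`).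

BC3 audit (planner folder `bc/`, 2026-08-17, farm `lean check --json`): this file rc 0, errors [],
sorries 2 = the two `stub_*` (the two `declaration uses sorry` warnings sit exactly on
`stub_sectorChessboard` and `stub_slicedWindowBound`), `#print axioms ThermalWindowMajorant_of` =
[propext, Classical.choice, Quot.sound] (no `sorryAx`). Probes (files `bc/<Stub>_probe.lean` and
`bc/<Stub>_probe_split.lean`, importing only the route file + a verbatim copy of the stub `def`):
for each stub `S ∈ {SectorChessboard, SlicedWindowBound}` both `S → ThermalWindowMajorant` and
`S → _root_.HubbardSuperconductivity` by `first | exact? | simpa [S] | (unfold S; simpa) | aesop`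
under `maxHeartbeats 400000` FAIL, and so does each alternative run on its own (`exact?`: "could not
close the goal" 4/4; `simpa [S]` / `unfold S; simpa`: "assumption failed" for `SectorChessboard`,
whnf/isDefEq heartbeat exhaustion for `SlicedWindowBound`; `aesop`: "failed to prove the goal after
exhaustive search" 4/4) — 20/20 probes fail: no stub is cheaply the crux or the summit. Numerical
sanity check of Stub A (600 random instances, `n ≤ 5`, `N ∈ {2,4}`, Hermitian and `e^{-aW}`-type
`X`, both signs of `β`): no violation, worst relative slack `-1.8e-13` (equality cases).
-/

noncomputable section

-- `Summit.<Summit>.<Problem>`: the single-conjunct summit repeats `HubbardSuperconductivity` (D-0017).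
set_option linter.dupNamespace false

namespace Summit.HubbardSuperconductivity.HubbardSuperconductivity.Cruxes.ThermalWindowMajorant.Birth

open Matrix Literature.MathematicalPhysics.QuantumLattice
open Summit.HubbardSuperconductivity.HubbardSuperconductivity.Theses.GibbsMajorant

/-! ## Stub statements -/

/-- **Stub A — sector time-chessboard estimate (reflection positivity in imaginary time, inside a
sector).** For a Hermitian `H`, an orthogonal projection `P` (`Pᴴ = P = P²`) commuting with `H`, a
Hermitian `X`, a real `β` and a dyadic number of slices `N = 2^(c+1)`:
`(Re Tr(e^{-βH} PXP))^N ≤ Re Tr((PXP · e^{-βH/N})^N) · (Re Tr(e^{-βH} P))^{N-1}`.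
(Tracial Hölder with exponents all equal to `N`; the dyadic case by iterated Schwarz.) The case
`P = 1` is the route's support `TimeChessboard`. [cite: FrohlichIsraelLiebSimon1978, Thm 4.1]
[cite: DysonLiebSimon1978, §3] -/
def SectorChessboard : Prop :=
  ∀ (n : Type) [Fintype n] [DecidableEq n] (H P X : Matrix n n ℂ) (β : ℝ) (c : ℕ),
    H.IsHermitian → P.IsHermitian → P * P = P → Commute P H → X.IsHermitian →
      (Matrix.trace (Matrix.gibbsWeight β H * (P * X * P))).re ^ 2 ^ (c + 1) ≤
        (Matrix.trace ((P * X * P * Matrix.gibbsWeight (β / 2 ^ (c + 1)) H) ^ 2 ^ (c + 1))).re *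
          (Matrix.trace (Matrix.gibbsWeight β H * P)).re ^ (2 ^ (c + 1) - 1)

/-- **Stub B — the sliced window bound (THE PHYSICS).** In the notation of the crux
(`D m` the momentum-`m` d-wave pair field, `W` the Kac window operator of radius `ε`,
`H = hubbardTorus 2 L 1 U`, `S = szSector N_L 0`, `P` its projector, `E₀ = H.minEnergyOn S`,
`Z_S = Re Tr(e^{-βH} P)`): there are `U > 0`, `δ ∈ (0,1/2)`, `θ > 0`, `ε₁ > 0` such that for every
`ε ∈ (0, ε₁]` some FIXED `β > 0` works eventually in even `L` with some tilt `a ≥ 0` and some dyadic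
slice number `N = 2^(c+1) ≥ 2`:
`Re Tr((P e^{-aW} P · e^{-βH/N})^N) · Z_S^{N-1} ≤ (e^{-(βE₀ + aθL²)}/2)^N`. -/
def SlicedWindowBound : Prop :=
  ∃ U : ℝ, 0 < U ∧ ∃ δ ∈ Set.Ioo (0:ℝ) (1 / 2), ∃ θ ε₁ : ℝ, 0 < θ ∧ 0 < ε₁ ∧ ∀ ε ∈ Set.Ioc (0:ℝ) ε₁, ∃ β : ℝ, 0 < β ∧ ∃ L₀ : ℕ, ∀ (L : ℕ) [NeZero L], L₀ ≤ L → Even L → ∃ a : ℝ, 0 ≤ a ∧ ∃ c : ℕ, let D : (Fin 2 → ZMod L) → Matrix (Finset (Literature.MathematicalPhysics.QuantumLattice.Orb (Literature.MathematicalPhysics.QuantumLattice.FermionTorus 2 L))) (Finset (Literature.MathematicalPhysics.QuantumLattice.Orb (Literature.MathematicalPhysics.QuantumLattice.FermionTorus 2 L))) ℂ := fun m => ∑ x : Fin 2 → ZMod L, Complex.exp (-(2 * Real.pi * Complex.I * (((∑ i : Fin 2, m i * x i).val : ℕ) : ℂ) / (L : ℂ))) • Literature.MathematicalPhysics.QuantumLattice.localPair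 Literature.MathematicalPhysics.QuantumLattice.dWaveFormFactor L x; let W : Matrix (Finset (Literature.MathematicalPhysics.QuantumLattice.Orb (Literature.MathematicalPhysics.QuantumLattice.FermionTorus 2 L))) (Finset (Literature.MathematicalPhysics.QuantumLattice.Orb (Literature.MathematicalPhysics.QuantumLattice.FermionTorus 2 L))) ℂ := ∑ m : Fin 2 → ZMod L, if (2 * Real.pi / (L : ℝ)) ^ 2 * (∑ i : Fin 2, (((m i).valMinAbs : ℤ) : ℝ) ^ 2) ≤ ε ^ 2 then ((L : ℂ) ^ 2)⁻¹ • (Matrix.conjTranspose (D m) * D m) else 0; let H := Literature.MathematicalPhysics.QuantumLattice.hubbardTorus 2 L 1 U; let S := Literature.MathematicalPhysics.QuantumLattice.szSector (Λ := Literature.MathematicalPhysics.QuantumLattice.FermionTorus 2 L) (2 * ⌊(1 - δ) * (L : ℝ) ^ 2 / 2⌋₊) 0; let P := Literature.MathematicalPhysics.QuantumLattice.projMatrix (S.map (Literature.MathematicalPhysics.QuantumLattice.Fock.toEuclidean (ι := Literature.MathematicalPhysics.QuantumLattice.Orb (Literature.MathematicalPhysics.QuantumLattice.FermionTorus 2 L))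 : Literature.MathematicalPhysics.QuantumLattice.Fock (Literature.MathematicalPhysics.QuantumLattice.Orb (Literature.MathematicalPhysics.QuantumLattice.FermionTorus 2 L)) →ₗ[ℂ] EuclideanSpace ℂ (Finset (Literature.MathematicalPhysics.QuantumLattice.Orb (Literature.MathematicalPhysics.QuantumLattice.FermionTorus 2 L))))); (Matrix.trace ((P * Matrix.gibbsWeight a W * P * Matrix.gibbsWeight (β / 2 ^ (c + 1)) H) ^ 2 ^ (c + 1))).re * (Matrix.trace (Matrix.gibbsWeight β H * P)).re ^ (2 ^ (c + 1) - 1) ≤ (Real.exp (-(β * H.minEnergyOn S + a * θ * (L : ℝ) ^ 2)) / 2) ^ 2 ^ (c + 1)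

/-! ## Registered stubs -/

/-- stub A: the sector time-chessboard (tracial Hölder at dyadic slice numbers; provable now). -/
theorem stub_sectorChessboard : SectorChessboard := by
  sorry

/-- stub B: the sliced window bound (hardest stub; the open core of the crux). -/
theorem stub_slicedWindowBound : SlicedWindowBound := by
  sorry

/-! ## Name-keyed aliases of the two stub statements — the hypotheses of `ThermalWindowMajorant_of`

The native skeleton audit (`#h21_check_skeleton`) admits a hypothesis of the skeleton theorem only if
its head constant is a registered obligation or is NAMED like a declared stub; `__Registered.stub_X`
is the statement of `stub_X` under that name (device of
`AtomisticToContinuum/BoseEinsteinCondensation/Cruxes/AmplitudeLDP/Lines/birth.lean`). Each alias is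
`rfl`-equal to its statement. -/
namespace __Registered

/-- Alias of `SectorChessboard` keyed by the registered stub name. -/
abbrev stub_sectorChessboard : Prop := SectorChessboard
/-- Alias of `SlicedWindowBound` keyed by the registered stub name. -/
abbrev stub_slicedWindowBound : Prop := SlicedWindowBound

end __Registered

/-! ## Sorry-free infrastructure: root extraction -/

/-- **Root extraction (abstract form of the composition).** If the sector chessboard holds and the
`N`-slice penalty-inserted trace obeys `M · Z^{N-1} ≤ (e^{-E'}/2)^N` (`N = 2^(c+1)`), then the
one-slice tilted trace obeys `e^{E'} · Re Tr(e^{-βH} PXP) ≤ 1/2`: chain `T^N ≤ M·Z^{N-1} ≤ t^N`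
with `t = e^{-E'}/2 > 0`, so `T ≤ t` (`pow_lt_pow_left₀` contraposed), then multiply by `e^{E'}`.
[folklore] -/
theorem crux_body_of_sliced {n : Type} [Fintype n] [DecidableEq n] (hC : SectorChessboard)
    {H P X : Matrix n n ℂ} (hH : H.IsHermitian) (hP : P.IsHermitian) (hPP : P * P = P)
    (hPH : Commute P H) (hX : X.IsHermitian) (β E' : ℝ) (c : ℕ)
    (hb : (Matrix.trace ((P * X * P * Matrix.gibbsWeight (β / 2 ^ (c + 1)) H) ^ 2 ^ (c + 1))).re *
        (Matrix.trace (Matrix.gibbsWeight β H * P)).re ^ (2 ^ (c + 1) - 1) ≤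
        (Real.exp (-E') / 2) ^ 2 ^ (c + 1)) :
    Real.exp E' * (Matrix.trace (Matrix.gibbsWeight β H * (P * X * P))).re ≤ 1 / 2 := by
  set N : ℕ := 2 ^ (c + 1) with hN
  set T : ℝ := (Matrix.trace (Matrix.gibbsWeight β H * (P * X * P))).re with hT
  set t : ℝ := Real.exp (-E') / 2 with ht
  have hNne : N ≠ 0 := pow_ne_zero _ two_ne_zero
  have htpos : 0 < t := by positivity
  have hTN : T ^ N ≤ t ^ N := (hC n H P X β c hH hP hPP hPH hX).trans hb
  have hTt : T ≤ t := by
    refine le_of_not_gt fun hlt => ?_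
    have h := pow_lt_pow_left₀ hlt htpos.le hNne
    linarith
  calc Real.exp E' * T ≤ Real.exp E' * t := mul_le_mul_of_nonneg_left hTt (Real.exp_pos _).le
    _ = 1 / 2 := by
        rw [ht, mul_div_assoc', ← Real.exp_add, add_neg_cancel, Real.exp_zero]

/-! ## Composition: the crux BY NAME from the two stub statements (no `sorry` below) -/

/-- **ThermalWindowMajorant_of** — sector chessboard (A) × sliced window bound (B) ⟹ the crux
`ThermalWindowMajorant`: thread B's witnesses `(U, δ, θ, ε₁; β, L₀; a, c)` through the crux's
quantifiers, then apply `crux_body_of_sliced` at `H = hubbardTorus 2 L 1 U`, `P` = the projector of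
`szSector N_L 0` (Hermitian, idempotent, commuting with `H`) and `X = e^{-aW_ε}` (Hermitian since
`W_ε` is). Hypotheses = the two stub statements under their registered names
(`__Registered.stub_X` is `X` by `rfl`); conclusion = the route decl, by name. [folklore] -/
theorem ThermalWindowMajorant_of (hC : __Registered.stub_sectorChessboard)
    (hB : __Registered.stub_slicedWindowBound) :
    Summit.HubbardSuperconductivity.HubbardSuperconductivity.Theses.GibbsMajorant.ThermalWindowMajorant := by
  obtain ⟨U, hU, δ, hδ, θ, ε₁, hθ, hε₁, hmain⟩ := hB
  refine ⟨U, hU, δ, hδ, θ, ε₁, hθ, hε₁, fun ε hε => ?_⟩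
  obtain ⟨β, hβ, L₀, hL⟩ := hmain ε hε
  refine ⟨β, hβ, L₀, fun L _ hL₀ hEven => ?_⟩
  obtain ⟨a, ha, c, hbound⟩ := hL L hL₀ hEven
  refine ⟨a, ha, ?_⟩
  intro D W H S P
  have hH : H.IsHermitian := LiebThm1.hamiltonian_isHermitian _ 1 U
  have hP : P.IsHermitian := projMatrix_isHermitian _
  have hPP : P * P = P := projMatrix_mul_self _
  have hPH : Commute P H := (projMatrix_szSector_commute (L := L) 1 U _ 0).1
  have hW : W.IsHermitian := by
    refine (isSelfAdjoint_sum Finset.univ fun m _ => ?_).isHermitian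
    split_ifs
    · refine ((Matrix.isHermitian_conjTranspose_mul_self (D m)).smul ?_).isSelfAdjoint
      rw [IsSelfAdjoint, ← Complex.ofReal_natCast, ← Complex.ofReal_pow, ← Complex.ofReal_inv,
        Complex.star_def, Complex.conj_ofReal]
    · exact IsSelfAdjoint.zero _
  have hX : (Matrix.gibbsWeight a W).IsHermitian := Matrix.isHermitian_gibbsWeight a hW
  exact crux_body_of_sliced hC hH hP hPP hPH hX β _ c hbound

/-- Wiring check (an `example`, so that `ThermalWindowMajorant_of` stays the only theorem concluding
the crux): the registered stubs feed the skeleton theorem as stated — this term becomes the crux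
proof when the two `sorry`s above are discharged. -/
example : Summit.HubbardSuperconductivity.HubbardSuperconductivity.Theses.GibbsMajorant.ThermalWindowMajorant :=
  ThermalWindowMajorant_of stub_sectorChessboard stub_slicedWindowBound

/-- The plain-arrow form `<stub sigs> → ThermalWindowMajorant` of the skeleton theorem. -/
example : SectorChessboard → SlicedWindowBound →
    Summit.HubbardSuperconductivity.HubbardSuperconductivity.Theses.GibbsMajorant.ThermalWindowMajorant :=
  ThermalWindowMajorant_of

end Summit.HubbardSuperconductivity.HubbardSuperconductivity.Cruxes.ThermalWindowMajorant.Birth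

end
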